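import Summits.Ventures.HSemireg.GeneralStructureTrackW
import Summits.Ventures.HSemireg.Leverage
import HarnessLib

/-!
# Venture HSemireg — DOOR #2 (Prym, level `N = 5`, `K = ℚ(i)`, split component): the formal target of a tenfold pass, as ONE name per door

HONEST FRAMING. Lean index of the computation cell `pub-hsemireg` (Lean seat p3); nothing about any explicit variety is asserted;
every published input is a hypothesis BY NAME; no new definition; nothing here says HC / HC_CM / HC_AV is proved. The cell's
DOOR #2 (lead ruling R-32/R-33, `step0/PRYM-DOOR-p1.md` §6–§9) is an object on a SPLIT `ℚ(i)`-Weil abelian TENFOLD (a generic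
genus-6 Prym `P` squared, secant structure); its payoff «all `ℚ(i)`-Weil eightfolds / sixfolds / fourfolds, every discriminant» is
the tree's ladder (`stub_descend`, Schoen's product transfer, PROVED) read from level `5`. The wiring already exists as a
two-step composition (`GeneralStructure.splitHyperplane_of_reach_of_BF_of_sheafSeed` + `GeneralStructure.weilAlgebraicAll_of_splitHyperplane_lt`;
`weilAlgebraicAll_of_localAnchor_succ` + `stub_descend`); this file records the PER-`d`, PER-LEVEL single-name forms and the two
`N = 5`, `d = 1` instances, so that a certified object instantiates exactly one declaration:

* `weilAlgebraicAll_of_sheafSeed_lt` — door D2 (finite locally free `I`-semiregular `ℰ₀`, Buchweitz–Flenner Thm. 5.1, REFEREED):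
  reach ∧ BF 5.1 ∧ `HasHyperbolicBFSheafSeed C N d I` ⟹ `WeilAlgebraicAll n d` for every `2 ≤ n < N` (same `d`).
* `weilAlgebraicAll_of_localAnchor_lt` — door D3-type input (a locally algebraic hyperbolic anchor at level `N`, e.g. from the tree's
  `WeilTypeLadder.hasLocallyAlgebraicWeilAnchor_of_perryTwisted_kappaAnchorObject N d`: fully semiregular locally free `ℰ₀` + rational
  `B`-field, `κ`-shape, Perry claim-fact UNREFEREED): reach ∧ `HasLocallyAlgebraicWeilAnchor N d` ⟹ `WeilAlgebraicAll n d`, `2 ≤ n < N`.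
* `weilAlgebraicAll_discOne_of_sheafSeed_five`, `weilAlgebraicAll_discOne_of_localAnchor_five` — the DOOR #2 instances:
  level `5`, `d = 1` ⟹ `WeilAlgebraicAll 4 1 ∧ WeilAlgebraicAll 3 1 ∧ WeilAlgebraicAll 2 1`.

CAVEAT C1 (unchanged): the sheaf door is typed for FINITE LOCALLY FREE `ℰ₀` on the TENFOLD only; DOOR #2b's object as Markman uses it
(a `K`-secant sheaf/complex `F` on the FIVEFOLD `P`, transferred through the twisted reflexive `Φ(F ⊠ F^∨)` on `P × P̂`) has NO typed
door — neither Buchweitz–Flenner 5.1 for complexes nor Markman's general-`n` secant theorem is rendered in the tree.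

References: [BuchweitzFlenner2003] §5 Thm. 5.1; [Deligne1982HodgeCycles] proof of Thm. 4.8; [Schoen1998HodgeWeilAddendum] §10;
[vanGeemen1994HodgeAV] 5.5; [Markman2025SecantWeil] §1.5 (preprint); [Markman2025SurveySecant] §11.5 Step 2 (preprint).
-/

noncomputable section

open CategoryTheory

namespace Summit.Ventures.HSemireg

open Literature.AlgebraicGeometry Literature.AlgebraicGeometry.Motives
open Literature.AlgebraicGeometry.HodgeTheory
open Summit.HodgeConjecture.HodgeConjecture
open Summit.HodgeConjecture.HodgeConjecture.WeilTypeLadder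
open Summit.HodgeConjecture.HodgeConjecture.Cruxes.HodgeAbelianVarieties.EStepSecantInduction
open Summit.HodgeConjecture.HodgeConjecture.Cruxes.HodgeAbelianVarieties.PrymCanonicalZ3SplitSeeds.Stubs.WeilSectorOffReach
  (splitHyperplane_of_weilAlgebraicAll)
open Summit.Ventures.HSemireg.GeneralStructure

/-- **Door D2, per `d`, read below the seed level**: Deligne's hyperbolic reach (`weilFamilyReach_hyperbolic`, refereed named fact) ∧
Buchweitz–Flenner Thm. 5.1 (`BuchweitzFlenner2003_variationalHodge_ISemiregular`, refereed named fact, finite locally free `ℰ₀`) ∧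
ONE hyperbolic `I`-semiregular sheaf seed at level `N` for `K = ℚ(√-d)` ⟹ every rational `(n,n)` Weil class on every `√-d`-Weil
abelian `2n`-fold is algebraic, for every `2 ≤ n < N` (split level `N` by `GeneralStructure.splitHyperplane_of_reach_of_BF_of_sheafSeed`,
then the PROVED descent `GeneralStructure.weilAlgebraicAll_of_splitHyperplane_lt`). [cite: BuchweitzFlenner2003, §5 Thm. 5.1]
[cite: Deligne1982HodgeCycles, proof of Thm. 4.8] [cite: Schoen1998HodgeWeilAddendum, §10] -/
theorem weilAlgebraicAll_of_sheafSeed_lt (hF : weilFamilyReach_hyperbolic) {C : ChernCharacterBetti} {N d : ℕ} {I : Finset ℕ}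
    (hBF : BuchweitzFlenner2003_variationalHodge_ISemiregular) (hS : HasHyperbolicBFSheafSeed C N d I) {n : ℕ} (hn : 2 ≤ n)
    (hnN : n < N) (hd : 0 < d) : WeilAlgebraicAll n d :=
  weilAlgebraicAll_of_splitHyperplane_lt hn hnN hd (splitHyperplane_of_reach_of_BF_of_sheafSeed hF (by omega) hd hBF hS)

/-- **Door D3-type input, per `d`, read below the anchor level**: Deligne's hyperbolic reach ∧ a locally algebraic hyperbolic
`√-d`-anchor at level `N ≥ 3` (`HasLocallyAlgebraicWeilAnchor N d`; supplied e.g. by the tree's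
`WeilTypeLadder.hasLocallyAlgebraicWeilAnchor_of_perryTwisted_kappaAnchorObject N d` from a fully semiregular locally free `κ`-object with
a rational `B`-field, granting Perry's twisted theorem) ⟹ `WeilAlgebraicAll n d` for every `2 ≤ n < N` (`weilAlgebraicAll_of_localAnchor_succ`
at `N - 1`, then the PROVED descent). [cite: Deligne1982HodgeCycles, proof of Thm. 4.8] [cite: Schoen1998HodgeWeilAddendum, §10] -/
theorem weilAlgebraicAll_of_localAnchor_lt (hF : weilFamilyReach_hyperbolic) {N d : ℕ} (hL : HasLocallyAlgebraicWeilAnchor N d)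
    {n : ℕ} (hn : 2 ≤ n) (hnN : n < N) (hd : 0 < d) : WeilAlgebraicAll n d := by
  obtain ⟨M, rfl⟩ : ∃ M, N = M + 1 := ⟨N - 1, by omega⟩
  have hM : WeilAlgebraicAll M d := weilAlgebraicAll_of_localAnchor_succ M d (by omega) hd hF hL
  rcases Nat.lt_or_ge n M with hlt | hge
  · exact weilAlgebraicAll_of_splitHyperplane_lt hn hlt hd (splitHyperplane_of_weilAlgebraicAll hM)
  · obtain rfl : n = M := by omega
    exact hM

/-- **DOOR #2, sheaf form (instance `N = 5`, `d = 1`)**: reach ∧ BF 5.1 ∧ ONE hyperbolic locally free `I`-semiregular sheaf seed on a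
split `ℚ(i)`-Weil abelian TENFOLD ⟹ every rational Weil class on every `ℚ(i)`-Weil abelian eightfold, sixfold and fourfold (every
discriminant, split and non-split) is algebraic. [cite: BuchweitzFlenner2003, §5 Thm. 5.1] [cite: Schoen1998HodgeWeilAddendum, §10] -/
theorem weilAlgebraicAll_discOne_of_sheafSeed_five (hF : weilFamilyReach_hyperbolic) {C : ChernCharacterBetti} {I : Finset ℕ}
    (hBF : BuchweitzFlenner2003_variationalHodge_ISemiregular) (hS : HasHyperbolicBFSheafSeed C 5 1 I) :
    WeilAlgebraicAll 4 1 ∧ WeilAlgebraicAll 3 1 ∧ WeilAlgebraicAll 2 1 :=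
  ⟨weilAlgebraicAll_of_sheafSeed_lt hF hBF hS (by norm_num) (by norm_num) one_pos,
    weilAlgebraicAll_of_sheafSeed_lt hF hBF hS (by norm_num) (by norm_num) one_pos,
    weilAlgebraicAll_of_sheafSeed_lt hF hBF hS le_rfl (by norm_num) one_pos⟩

/-- **DOOR #2, local-anchor form (instance `N = 5`, `d = 1`)**: reach ∧ a locally algebraic hyperbolic `ℚ(i)`-anchor in dimension
`10` ⟹ every rational Weil class on every `ℚ(i)`-Weil abelian eightfold, sixfold and fourfold is algebraic.
[cite: Deligne1982HodgeCycles, proof of Thm. 4.8] [cite: Schoen1998HodgeWeilAddendum, §10] -/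
theorem weilAlgebraicAll_discOne_of_localAnchor_five (hF : weilFamilyReach_hyperbolic) (hL : HasLocallyAlgebraicWeilAnchor 5 1) :
    WeilAlgebraicAll 4 1 ∧ WeilAlgebraicAll 3 1 ∧ WeilAlgebraicAll 2 1 :=
  ⟨weilAlgebraicAll_of_localAnchor_lt hF hL (by norm_num) (by norm_num) one_pos,
    weilAlgebraicAll_of_localAnchor_lt hF hL (by norm_num) (by norm_num) one_pos,
    weilAlgebraicAll_of_localAnchor_lt hF hL le_rfl (by norm_num) one_pos⟩

end Summit.Ventures.HSemireg

end
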